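import Literature.Topology.FourManifolds.SurgeryTubeCylinderFrame
import Literature.Topology.FourManifolds.SphereFamilySurgeryExistence
import HarnessLib

/-!
# Cylinder frames of a spherical modification, VI: the handle cone and the handle cylinder frame

Topic `Literature/Topology/FourManifolds` (fact seat of
`Literature.Topology.FourManifolds.HomotopySphere.boundsContractible_of_nullCobordism_isStablyParallelizable_four`;
towards Kervaire–Milnor's Lemma 5.4 / 6.2).  The handle-side mirror image of
`SurgeryCylinderFrames.lean` / `SurgeryTubeCylinderFrame.lean`: the handle piece
`OD^{k+1} × Sˡ` of a surgery (`SphereSurgery.Handle ι k l hkl`) is parametrised by the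
**handle cone** `Ψᵢ(y, x) = (i, y, x/‖x‖)` from the open subset `{‖y‖ < 1, x ≠ 0}` of the flat
`E = ℝᵏ⁺¹ × ℝˡ⁺¹`, and the **handle cylinder frame** `cylR (y, v) h dΨ_{(y,v)}`
(`SurgerySwapMatrix.cylR`) is a stable frame of `T Handle ⊕ ℝ` at every point `(y, v)`,
`‖y‖ < 1`, the new core `y = 0` included:

* `SphereSurgery.handleCone`, `handleCone_apply`, `contMDiffOn_handleCone`,
  `handleCone_smul` (constant along the rays `c ↦ (y, c • x)`);
* `SphereSurgery.handleDeriv y v = dΨ_{(y, v)}`, `handleDeriv_apply_normal` (kills `(0, v)`),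
  `hypR`/`mfderiv_hypR_apply`, `handleDeriv_comp_eq` (`dΨ ∘ d(id × incl) = dΨ₀` for the handle
  chart `Ψ₀(y, v) = (i, y, v)`), `injective_mfderiv_handleChart` (left inverse
  `snd ∘ val ∘ ofHandle`), `eq_zero_of_handleDeriv_eq_zero` (injective on `⟪v, ·₂⟫ = 0`);
* `SphereSurgery.handleCyl`, `linearIndependent_handleCyl`, `isFrameFieldAlong_handleCyl`.

Everything is proved; the `def`s are explicit; no named facts.

## References

* J. Milnor, *Lectures on the h-cobordism theorem* (1965), Def. 3.11. [MilnorHCobordism1965]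
* M. Kervaire, J. Milnor, *Groups of homotopy spheres I*, Ann. of Math. (2) 77 (1963), §6
  pp. 520–522. doi:10.2307/1970128 [KervaireMilnorAnnals1963]
-/

noncomputable section

open scoped Manifold ContDiff Topology RealInnerProductSpace
open Set Function Bundle Metric Module

namespace Literature.Topology.FourManifolds

open StableFrames StableFrames.SurgerySwap

namespace SphereSurgery

universe u

attribute [local instance] fact_finrank_euclideanSpace_succ

variable {ι : Type u} {k l n : ℕ} (hkl : k + l = n) (i : ι)

/-- **The handle cone** `Ψᵢ(y, x) = (i, y, x/‖x‖) ∈ OD^{k+1} × Sˡ ⊂ Handle` on `‖y‖ < 1` (junk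
`y`-value `0` off the ball; junk direction at `x = 0`). [cite: MilnorHCobordism1965, Def. 3.11] -/
def handleCone (q : EuclideanSpace ℝ (Fin (k + 1)) × EuclideanSpace ℝ (Fin (l + 1))) : Handle ι k l hkl :=
  if hq : ‖q.1‖ < 1 then
    toHandle ι k l hkl ⟨(DiscreteIndex.mk i, (q.1, radialProjection (spherePt l) q.2)),
      (mem_ballTimesSphere_iff _).2 hq⟩
  else
    toHandle ι k l hkl ⟨(DiscreteIndex.mk i, (0, radialProjection (spherePt l) q.2)),
      (mem_ballTimesSphere_iff _).2 (by simp)⟩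

/-- The handle cone on the ball. [folklore] -/
theorem handleCone_apply {q : EuclideanSpace ℝ (Fin (k + 1)) × EuclideanSpace ℝ (Fin (l + 1))}
    (hq : ‖q.1‖ < 1) :
    handleCone hkl i q = toHandle ι k l hkl ⟨(DiscreteIndex.mk i, (q.1, radialProjection (spherePt l) q.2)),
      (mem_ballTimesSphere_iff _).2 hq⟩ := by
  rw [handleCone, dif_pos hq]

/-- The handle cone is constant along the rays `c ↦ (y, c • x)`, `c > 0`. [folklore] -/
theorem handleCone_smul {c : ℝ} (hc : 0 < c) (y : EuclideanSpace ℝ (Fin (k + 1)))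
    (v : Metric.sphere (0 : EuclideanSpace ℝ (Fin (l + 1))) 1) :
    handleCone hkl i (y, c • (v : EuclideanSpace ℝ (Fin (l + 1)))) =
      handleCone hkl i (y, (v : EuclideanSpace ℝ (Fin (l + 1)))) := by
  simp only [handleCone, radialProjection_smul _ hc, radialProjection_coe_sphere]

/-- The underlying point of the handle cone in `ι × ℝᵏ⁺¹ × Sˡ`, on the ball. [folklore] -/
theorem ofHandle_handleCone {q : EuclideanSpace ℝ (Fin (k + 1)) × EuclideanSpace ℝ (Fin (l + 1))}
    (hq : ‖q.1‖ < 1) :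
    ((ofHandle ι k l hkl (handleCone hkl i q) : ↥(ballTimesSphere ι k l)) :
        DiscreteIndex ι × (EuclideanSpace ℝ (Fin (k + 1)) × Metric.sphere (0 : EuclideanSpace ℝ (Fin (l + 1))) 1)) =
      (DiscreteIndex.mk i, (q.1, radialProjection (spherePt l) q.2)) := by
  rw [handleCone_apply hkl i hq, ofHandle_toHandle]

/-- **The handle cone is `C^∞` on `{‖y‖ < 1} × {x ≠ 0}`.** [folklore] -/
theorem contMDiffOn_handleCone :
    ContMDiffOn ((𝓘(ℝ, EuclideanSpace ℝ (Fin (k + 1)))).prod 𝓘(ℝ, EuclideanSpace ℝ (Fin (l + 1))))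
      (𝓡∂ (n + 1)) ∞ (handleCone hkl i) {q | ‖q.1‖ < 1 ∧ q.2 ≠ 0} := by
  have hO : IsOpen {q : EuclideanSpace ℝ (Fin (k + 1)) × EuclideanSpace ℝ (Fin (l + 1)) |
      ‖q.1‖ < 1 ∧ q.2 ≠ 0} :=
    (isOpen_lt (continuous_norm.comp continuous_fst) continuous_const).inter
      (isOpen_ne.preimage continuous_snd)
  -- the map into the open piece, as a map into the ambient product manifold
  set g : EuclideanSpace ℝ (Fin (k + 1)) × EuclideanSpace ℝ (Fin (l + 1)) → ↥(ballTimesSphere ι k l) :=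
    fun q => ofHandle ι k l hkl (handleCone hkl i q) with hg
  have hg' : ∀ q ∈ {q : EuclideanSpace ℝ (Fin (k + 1)) × EuclideanSpace ℝ (Fin (l + 1)) | ‖q.1‖ < 1 ∧ q.2 ≠ 0},
      ContMDiffAt ((𝓘(ℝ, EuclideanSpace ℝ (Fin (k + 1)))).prod 𝓘(ℝ, EuclideanSpace ℝ (Fin (l + 1))))
        (handleModelWithCorners k l) ∞ g q := by
    intro q hq
    rw [← ContMDiffAt.subtypeVal_comp_iff]
    have hev : (Subtype.val ∘ g) =ᶠ[𝓝 q] fun q =>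
        (DiscreteIndex.mk i, (q.1, radialProjection (spherePt l) q.2)) := by
      filter_upwards [hO.mem_nhds hq] with q' hq'
      exact ofHandle_handleCone hkl i hq'.1
    refine ContMDiffAt.congr_of_eventuallyEq ?_ hev
    refine contMDiffAt_const.prodMk (contMDiffAt_fst.prodMk ?_)
    exact ((contMDiffOn_radialProjection (spherePt l)).contMDiffAt
      ((isOpen_ne.mem_nhds hq.2))).comp q contMDiffAt_snd
  intro q hq
  have : handleCone hkl i = toHandle ι k l hkl ∘ g := by
    funext q'; simp [hg]
  rw [this]
  exact ((contMDiff_toHandle hkl _).comp q (hg' q hq)).contMDiffWithinAt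

/-- The handle cone is differentiable at the points of `{‖y‖ < 1} × {x ≠ 0}`. [folklore] -/
theorem mdifferentiableAt_handleCone {q : EuclideanSpace ℝ (Fin (k + 1)) × EuclideanSpace ℝ (Fin (l + 1))}
    (hq : ‖q.1‖ < 1 ∧ q.2 ≠ 0) :
    MDifferentiableAt ((𝓘(ℝ, EuclideanSpace ℝ (Fin (k + 1)))).prod 𝓘(ℝ, EuclideanSpace ℝ (Fin (l + 1))))
      (𝓡∂ (n + 1)) (handleCone hkl i) q := by
  have hO : IsOpen {q : EuclideanSpace ℝ (Fin (k + 1)) × EuclideanSpace ℝ (Fin (l + 1)) |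
      ‖q.1‖ < 1 ∧ q.2 ≠ 0} :=
    (isOpen_lt (continuous_norm.comp continuous_fst) continuous_const).inter
      (isOpen_ne.preimage continuous_snd)
  exact ((contMDiffOn_handleCone hkl i).contMDiffAt (hO.mem_nhds hq)).mdifferentiableAt (by simp)

/-- **The differential of the handle cone** `dΨ_{(y, v)}` at a point of the hypersurface
`ℝᵏ⁺¹ × Sˡ`, a linear map `ℝᵏ⁺¹ × ℝˡ⁺¹ → T Handle` (the `L'` of `SurgerySwapMatrix.cylR`).
[cite: KervaireMilnorAnnals1963, §6 p. 521] -/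
def handleDeriv (y : EuclideanSpace ℝ (Fin (k + 1))) (v : Metric.sphere (0 : EuclideanSpace ℝ (Fin (l + 1))) 1) :
    (EuclideanSpace ℝ (Fin (k + 1)) × EuclideanSpace ℝ (Fin (l + 1))) →L[ℝ] EuclideanSpace ℝ (Fin (n + 1)) :=
  mfderiv ((𝓘(ℝ, EuclideanSpace ℝ (Fin (k + 1)))).prod 𝓘(ℝ, EuclideanSpace ℝ (Fin (l + 1)))) (𝓡∂ (n + 1))
    (handleCone hkl i) (y, (v : EuclideanSpace ℝ (Fin (l + 1))))

/-- **`dΨ (0, v) = 0`**: the handle cone is constant along the fibre rays. [folklore] -/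
theorem handleDeriv_apply_normal {y : EuclideanSpace ℝ (Fin (k + 1))} (hy : ‖y‖ < 1)
    (v : Metric.sphere (0 : EuclideanSpace ℝ (Fin (l + 1))) 1) :
    handleDeriv hkl i y v (0, (v : EuclideanSpace ℝ (Fin (l + 1)))) = 0 := by
  have hv0 : (v : EuclideanSpace ℝ (Fin (l + 1))) ≠ 0 := ne_zero_of_mem_unit_sphere v
  set γ : ℝ → EuclideanSpace ℝ (Fin (k + 1)) × EuclideanSpace ℝ (Fin (l + 1)) :=
    fun t => (y, (1 + t) • (v : EuclideanSpace ℝ (Fin (l + 1)))) with hγ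
  have hγ0 : γ 0 = (y, (v : EuclideanSpace ℝ (Fin (l + 1)))) := by simp [hγ]
  set D : ℝ →L[ℝ] EuclideanSpace ℝ (Fin (k + 1)) × EuclideanSpace ℝ (Fin (l + 1)) :=
    (0 : ℝ →L[ℝ] EuclideanSpace ℝ (Fin (k + 1))).prod
      ((ContinuousLinearMap.id ℝ ℝ).smulRight (v : EuclideanSpace ℝ (Fin (l + 1)))) with hD
  have hγm : HasMFDerivAt 𝓘(ℝ, ℝ)
      ((𝓘(ℝ, EuclideanSpace ℝ (Fin (k + 1)))).prod 𝓘(ℝ, EuclideanSpace ℝ (Fin (l + 1)))) γ 0 D := by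
    have h1 : HasFDerivAt (fun _ : ℝ => y) (0 : ℝ →L[ℝ] EuclideanSpace ℝ (Fin (k + 1))) 0 :=
      hasFDerivAt_const y 0
    have h2 : HasFDerivAt (fun t : ℝ => (1 + t) • (v : EuclideanSpace ℝ (Fin (l + 1))))
        ((ContinuousLinearMap.id ℝ ℝ).smulRight (v : EuclideanSpace ℝ (Fin (l + 1)))) 0 :=
      ((hasFDerivAt_id (0 : ℝ)).const_add 1).smul_const _
    exact (hasMFDerivAt_iff_hasFDerivAt.2 h1).prodMk (hasMFDerivAt_iff_hasFDerivAt.2 h2)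
  have hconst : (handleCone hkl i ∘ γ) =ᶠ[𝓝 0] fun _ => handleCone hkl i (y, (v : EuclideanSpace ℝ (Fin (l + 1)))) := by
    have : Ioi (-1 : ℝ) ∈ 𝓝 (0 : ℝ) := Ioi_mem_nhds (by norm_num)
    filter_upwards [this] with t ht
    simp only [comp_apply, hγ]
    exact handleCone_smul hkl i (by linarith [mem_Ioi.1 ht]) y v
  have h1 : HasMFDerivAt 𝓘(ℝ, ℝ) (𝓡∂ (n + 1)) (handleCone hkl i ∘ γ) 0 ((handleDeriv hkl i y v).comp D) := by
    have hd := (mdifferentiableAt_handleCone hkl i (q := (y, (v : EuclideanSpace ℝ (Fin (l + 1))))) ⟨hy, hv0⟩).hasMFDerivAt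
    have hd' : HasMFDerivAt ((𝓘(ℝ, EuclideanSpace ℝ (Fin (k + 1)))).prod 𝓘(ℝ, EuclideanSpace ℝ (Fin (l + 1))))
        (𝓡∂ (n + 1)) (handleCone hkl i) (γ 0) (handleDeriv hkl i y v) := by
      rw [hγ0]; exact hd
    exact hd'.comp 0 hγm
  have h2 : HasMFDerivAt 𝓘(ℝ, ℝ) (𝓡∂ (n + 1)) (handleCone hkl i ∘ γ) 0
      (0 : TangentSpace 𝓘(ℝ, ℝ) (0 : ℝ) →L[ℝ]
        TangentSpace (𝓡∂ (n + 1)) ((handleCone hkl i ∘ γ) 0)) :=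
    (hasMFDerivAt_const (I := 𝓘(ℝ, ℝ)) (I' := 𝓡∂ (n + 1))
      (handleCone hkl i (y, (v : EuclideanSpace ℝ (Fin (l + 1))))) 0).congr_of_eventuallyEq hconst
  have heq := h1.mfderiv.symm.trans h2.mfderiv
  have key : (handleDeriv hkl i y v) (D 1) = 0 := DFunLike.congr_fun heq (1 : ℝ)
  simpa [hD] using key

/-- The inclusion `ℝᵏ⁺¹ × Sˡ → ℝᵏ⁺¹ × ℝˡ⁺¹`. [folklore] -/
def hypR (q : EuclideanSpace ℝ (Fin (k + 1)) × Metric.sphere (0 : EuclideanSpace ℝ (Fin (l + 1))) 1) :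
    EuclideanSpace ℝ (Fin (k + 1)) × EuclideanSpace ℝ (Fin (l + 1)) :=
  (q.1, (q.2 : EuclideanSpace ℝ (Fin (l + 1))))

/-- The inclusion `hypR` is `C^∞`. [folklore] -/
theorem contMDiff_hypR :
    ContMDiff ((𝓘(ℝ, EuclideanSpace ℝ (Fin (k + 1)))).prod (𝓡 l))
      ((𝓘(ℝ, EuclideanSpace ℝ (Fin (k + 1)))).prod 𝓘(ℝ, EuclideanSpace ℝ (Fin (l + 1)))) ∞
      (hypR (k := k) (l := l)) :=
  contMDiff_fst.prodMk ((contMDiff_coe_sphere (E := EuclideanSpace ℝ (Fin (l + 1))) (n := l)).comp contMDiff_snd)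

/-- The differential of `hypR` is `id × d(incl)`. [folklore] -/
theorem mfderiv_hypR (y : EuclideanSpace ℝ (Fin (k + 1))) (v : Metric.sphere (0 : EuclideanSpace ℝ (Fin (l + 1))) 1) :
    mfderiv ((𝓘(ℝ, EuclideanSpace ℝ (Fin (k + 1)))).prod (𝓡 l))
        ((𝓘(ℝ, EuclideanSpace ℝ (Fin (k + 1)))).prod 𝓘(ℝ, EuclideanSpace ℝ (Fin (l + 1)))) hypR (y, v) =
      (ContinuousLinearMap.fst ℝ (EuclideanSpace ℝ (Fin (k + 1))) (EuclideanSpace ℝ (Fin l))).prod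
        ((mfderiv (𝓡 l) 𝓘(ℝ, EuclideanSpace ℝ (Fin (l + 1)))
          (Subtype.val : Metric.sphere (0 : EuclideanSpace ℝ (Fin (l + 1))) 1 → _) v).comp
          (ContinuousLinearMap.snd ℝ (EuclideanSpace ℝ (Fin (k + 1))) (EuclideanSpace ℝ (Fin l)))) := by
  have hval : MDifferentiableAt (𝓡 l) 𝓘(ℝ, EuclideanSpace ℝ (Fin (l + 1)))
      (Subtype.val : Metric.sphere (0 : EuclideanSpace ℝ (Fin (l + 1))) 1 → _) v :=
    (contMDiff_coe_sphere (m := 1) (n := l) (E := EuclideanSpace ℝ (Fin (l + 1)))).mdifferentiableAt one_ne_zero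
  have h1 : HasMFDerivAt ((𝓘(ℝ, EuclideanSpace ℝ (Fin (k + 1)))).prod (𝓡 l)) 𝓘(ℝ, EuclideanSpace ℝ (Fin (k + 1)))
      (fun q : EuclideanSpace ℝ (Fin (k + 1)) × Metric.sphere (0 : EuclideanSpace ℝ (Fin (l + 1))) 1 => q.1) (y, v)
      (ContinuousLinearMap.fst ℝ (EuclideanSpace ℝ (Fin (k + 1))) (EuclideanSpace ℝ (Fin l))) :=
    hasMFDerivAt_fst (I := 𝓘(ℝ, EuclideanSpace ℝ (Fin (k + 1)))) (I' := 𝓡 l) _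
  have h2 : HasMFDerivAt ((𝓘(ℝ, EuclideanSpace ℝ (Fin (k + 1)))).prod (𝓡 l)) 𝓘(ℝ, EuclideanSpace ℝ (Fin (l + 1)))
      (fun q : EuclideanSpace ℝ (Fin (k + 1)) × Metric.sphere (0 : EuclideanSpace ℝ (Fin (l + 1))) 1 =>
        (q.2 : EuclideanSpace ℝ (Fin (l + 1)))) (y, v)
      ((mfderiv (𝓡 l) 𝓘(ℝ, EuclideanSpace ℝ (Fin (l + 1)))
          (Subtype.val : Metric.sphere (0 : EuclideanSpace ℝ (Fin (l + 1))) 1 → _) v).comp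
        (ContinuousLinearMap.snd ℝ (EuclideanSpace ℝ (Fin (k + 1))) (EuclideanSpace ℝ (Fin l)))) :=
    hval.hasMFDerivAt.comp (y, v)
      (hasMFDerivAt_snd (I := 𝓘(ℝ, EuclideanSpace ℝ (Fin (k + 1)))) (I' := 𝓡 l) _)
  unfold hypR
  exact (h1.prodMk h2).mfderiv

/-- Pointwise form of `mfderiv_hypR`. [folklore] -/
theorem mfderiv_hypR_apply (y : EuclideanSpace ℝ (Fin (k + 1))) (v : Metric.sphere (0 : EuclideanSpace ℝ (Fin (l + 1))) 1)
    (x₁ : EuclideanSpace ℝ (Fin (k + 1))) (ξ : EuclideanSpace ℝ (Fin l)) :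
    mfderiv ((𝓘(ℝ, EuclideanSpace ℝ (Fin (k + 1)))).prod (𝓡 l))
        ((𝓘(ℝ, EuclideanSpace ℝ (Fin (k + 1)))).prod 𝓘(ℝ, EuclideanSpace ℝ (Fin (l + 1)))) hypR (y, v) (x₁, ξ) =
      (x₁, mfderiv (𝓡 l) 𝓘(ℝ, EuclideanSpace ℝ (Fin (l + 1)))
        (Subtype.val : Metric.sphere (0 : EuclideanSpace ℝ (Fin (l + 1))) 1 → _) v ξ) := by
  rw [mfderiv_hypR]
  rfl

/-- **The handle chart** `Ψ₀(y, v) = Ψ(y, v) = (i, y, v)` on `ℝᵏ⁺¹ × Sˡ` (on the ball).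
[folklore] -/
def handleChart (q : EuclideanSpace ℝ (Fin (k + 1)) × Metric.sphere (0 : EuclideanSpace ℝ (Fin (l + 1))) 1) :
    Handle ι k l hkl :=
  handleCone hkl i (hypR q)

/-- `snd ∘ val ∘ ofHandle` is a left inverse of the handle chart on the ball. [folklore] -/
theorem leftInv_handleChart {q : EuclideanSpace ℝ (Fin (k + 1)) × Metric.sphere (0 : EuclideanSpace ℝ (Fin (l + 1))) 1}
    (hq : ‖q.1‖ < 1) :
    ((ofHandle ι k l hkl (handleChart hkl i q) : ↥(ballTimesSphere ι k l)) :
      DiscreteIndex ι × (EuclideanSpace ℝ (Fin (k + 1)) × Metric.sphere (0 : EuclideanSpace ℝ (Fin (l + 1))) 1)).2 = q := by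
  have h1 := ofHandle_handleCone hkl i (q := hypR q) hq
  rw [handleChart, h1]
  change (q.1, radialProjection (spherePt l) (q.2 : EuclideanSpace ℝ (Fin (l + 1)))) = q
  rw [radialProjection_coe_sphere]

/-- The handle chart is `C^∞` at the points of the ball. [folklore] -/
theorem contMDiffAt_handleChart {q : EuclideanSpace ℝ (Fin (k + 1)) × Metric.sphere (0 : EuclideanSpace ℝ (Fin (l + 1))) 1}
    (hq : ‖q.1‖ < 1) :
    ContMDiffAt ((𝓘(ℝ, EuclideanSpace ℝ (Fin (k + 1)))).prod (𝓡 l)) (𝓡∂ (n + 1)) ∞ (handleChart hkl i) q := by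
  have hO : IsOpen {q : EuclideanSpace ℝ (Fin (k + 1)) × EuclideanSpace ℝ (Fin (l + 1)) |
      ‖q.1‖ < 1 ∧ q.2 ≠ 0} :=
    (isOpen_lt (continuous_norm.comp continuous_fst) continuous_const).inter
      (isOpen_ne.preimage continuous_snd)
  have hmem : hypR q ∈ {q : EuclideanSpace ℝ (Fin (k + 1)) × EuclideanSpace ℝ (Fin (l + 1)) |
      ‖q.1‖ < 1 ∧ q.2 ≠ 0} := ⟨hq, ne_zero_of_mem_unit_sphere q.2⟩
  have h1 : ContMDiffAt ((𝓘(ℝ, EuclideanSpace ℝ (Fin (k + 1)))).prod 𝓘(ℝ, EuclideanSpace ℝ (Fin (l + 1))))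
      (𝓡∂ (n + 1)) ∞ (handleCone hkl i) (hypR q) :=
    (contMDiffOn_handleCone hkl i).contMDiffAt (hO.mem_nhds hmem)
  have h2 : ContMDiffAt ((𝓘(ℝ, EuclideanSpace ℝ (Fin (k + 1)))).prod (𝓡 l))
      ((𝓘(ℝ, EuclideanSpace ℝ (Fin (k + 1)))).prod 𝓘(ℝ, EuclideanSpace ℝ (Fin (l + 1)))) ∞ hypR q :=
    contMDiff_hypR q
  exact h1.comp q h2

/-- **The differential of the handle chart is injective** (it has the smooth left inverse
`snd ∘ val ∘ ofHandle`). [folklore] -/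
theorem injective_mfderiv_handleChart {q : EuclideanSpace ℝ (Fin (k + 1)) × Metric.sphere (0 : EuclideanSpace ℝ (Fin (l + 1))) 1}
    (hq : ‖q.1‖ < 1) :
    Injective (mfderiv ((𝓘(ℝ, EuclideanSpace ℝ (Fin (k + 1)))).prod (𝓡 l)) (𝓡∂ (n + 1)) (handleChart hkl i) q) := by
  set V : Handle ι k l hkl → EuclideanSpace ℝ (Fin (k + 1)) × Metric.sphere (0 : EuclideanSpace ℝ (Fin (l + 1))) 1 :=
    fun b => ((ofHandle ι k l hkl b : ↥(ballTimesSphere ι k l)) :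
      DiscreteIndex ι × (EuclideanSpace ℝ (Fin (k + 1)) × Metric.sphere (0 : EuclideanSpace ℝ (Fin (l + 1))) 1)).2 with hV
  have hVs : ContMDiff (𝓡∂ (n + 1)) ((𝓘(ℝ, EuclideanSpace ℝ (Fin (k + 1)))).prod (𝓡 l)) ∞ V :=
    contMDiff_snd.comp (contMDiff_subtype_val.comp (contMDiff_ofHandle hkl))
  -- `V ∘ Ψ₀ = id` near `q`
  have hO : IsOpen {q : EuclideanSpace ℝ (Fin (k + 1)) × Metric.sphere (0 : EuclideanSpace ℝ (Fin (l + 1))) 1 | ‖q.1‖ < 1} :=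
    isOpen_lt (continuous_norm.comp continuous_fst) continuous_const
  have hev : (V ∘ handleChart hkl i) =ᶠ[𝓝 q] id := by
    filter_upwards [hO.mem_nhds hq] with q' hq'
    exact leftInv_handleChart hkl i hq'
  have hd1 : MDifferentiableAt ((𝓘(ℝ, EuclideanSpace ℝ (Fin (k + 1)))).prod (𝓡 l)) (𝓡∂ (n + 1)) (handleChart hkl i) q :=
    (contMDiffAt_handleChart hkl i hq).mdifferentiableAt (by simp)
  have hd2 : MDifferentiableAt (𝓡∂ (n + 1)) ((𝓘(ℝ, EuclideanSpace ℝ (Fin (k + 1)))).prod (𝓡 l)) V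
      (handleChart hkl i q) := (hVs _).mdifferentiableAt (by simp)
  have hcomp := mfderiv_comp q hd2 hd1
  rw [hev.mfderiv_eq, mfderiv_id] at hcomp
  intro a b hab
  have ha : a = mfderiv (𝓡∂ (n + 1)) ((𝓘(ℝ, EuclideanSpace ℝ (Fin (k + 1)))).prod (𝓡 l)) V
      (handleChart hkl i q) (mfderiv ((𝓘(ℝ, EuclideanSpace ℝ (Fin (k + 1)))).prod (𝓡 l)) (𝓡∂ (n + 1))
        (handleChart hkl i) q a) := DFunLike.congr_fun hcomp a
  have hb : b = mfderiv (𝓡∂ (n + 1)) ((𝓘(ℝ, EuclideanSpace ℝ (Fin (k + 1)))).prod (𝓡 l)) V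
      (handleChart hkl i q) (mfderiv ((𝓘(ℝ, EuclideanSpace ℝ (Fin (k + 1)))).prod (𝓡 l)) (𝓡∂ (n + 1))
        (handleChart hkl i) q b) := DFunLike.congr_fun hcomp b
  rw [ha, hb]
  exact congrArg _ hab

/-- **`dΨ ∘ d(id × incl) = dΨ₀`** at a point of the hypersurface. [folklore] -/
theorem handleDeriv_comp_eq {y : EuclideanSpace ℝ (Fin (k + 1))} (hy : ‖y‖ < 1)
    (v : Metric.sphere (0 : EuclideanSpace ℝ (Fin (l + 1))) 1) :
    (handleDeriv hkl i y v).comp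
        (mfderiv ((𝓘(ℝ, EuclideanSpace ℝ (Fin (k + 1)))).prod (𝓡 l))
          ((𝓘(ℝ, EuclideanSpace ℝ (Fin (k + 1)))).prod 𝓘(ℝ, EuclideanSpace ℝ (Fin (l + 1)))) hypR (y, v)) =
      mfderiv ((𝓘(ℝ, EuclideanSpace ℝ (Fin (k + 1)))).prod (𝓡 l)) (𝓡∂ (n + 1)) (handleChart hkl i) (y, v) := by
  have hv0 : (v : EuclideanSpace ℝ (Fin (l + 1))) ≠ 0 := ne_zero_of_mem_unit_sphere v
  have hhyp : MDifferentiableAt ((𝓘(ℝ, EuclideanSpace ℝ (Fin (k + 1)))).prod (𝓡 l))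
      ((𝓘(ℝ, EuclideanSpace ℝ (Fin (k + 1)))).prod 𝓘(ℝ, EuclideanSpace ℝ (Fin (l + 1)))) hypR (y, v) :=
    (contMDiff_hypR (y, v)).mdifferentiableAt (by simp)
  have := mfderiv_comp (y, v) (mdifferentiableAt_handleCone hkl i (q := hypR (y, v)) ⟨hy, hv0⟩) hhyp
  exact this.symm

/-- **`dΨ` is injective on the hyperplane `⟪v, ·₂⟫ = 0`** (the `hL` of
`SurgerySwapMatrix.linearIndependent_cylR`). [folklore] -/
theorem eq_zero_of_handleDeriv_eq_zero {y : EuclideanSpace ℝ (Fin (k + 1))} (hy : ‖y‖ < 1)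
    (v : Metric.sphere (0 : EuclideanSpace ℝ (Fin (l + 1))) 1)
    (x : EuclideanSpace ℝ (Fin (k + 1)) × EuclideanSpace ℝ (Fin (l + 1)))
    (hx : ⟪(v : EuclideanSpace ℝ (Fin (l + 1))), x.2⟫ = 0) (h0 : handleDeriv hkl i y v x = 0) : x = 0 := by
  obtain ⟨ξ, hξ⟩ : ∃ ξ : TangentSpace (𝓡 l) v, mfderiv (𝓡 l) 𝓘(ℝ, EuclideanSpace ℝ (Fin (l + 1)))
      (Subtype.val : Metric.sphere (0 : EuclideanSpace ℝ (Fin (l + 1))) 1 → _) v ξ = x.2 := by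
    have hmem : x.2 ∈ (ℝ ∙ (v : EuclideanSpace ℝ (Fin (l + 1))))ᗮ :=
      Submodule.mem_orthogonal_singleton_iff_inner_right.2 hx
    rw [← range_mfderiv_coe_sphere (n := l) v] at hmem
    exact hmem
  have hcomp := DFunLike.congr_fun (handleDeriv_comp_eq hkl i hy v)
    ((x.1, ξ) : EuclideanSpace ℝ (Fin (k + 1)) × EuclideanSpace ℝ (Fin l))
  have e1 := mfderiv_hypR_apply y v x.1 ξ
  have hx' : ((x.1, mfderiv (𝓡 l) 𝓘(ℝ, EuclideanSpace ℝ (Fin (l + 1)))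
      (Subtype.val : Metric.sphere (0 : EuclideanSpace ℝ (Fin (l + 1))) 1 → _) v ξ) :
      EuclideanSpace ℝ (Fin (k + 1)) × EuclideanSpace ℝ (Fin (l + 1))) = x := Prod.ext rfl hξ
  have e2 : handleDeriv hkl i y v (mfderiv ((𝓘(ℝ, EuclideanSpace ℝ (Fin (k + 1)))).prod (𝓡 l))
      ((𝓘(ℝ, EuclideanSpace ℝ (Fin (k + 1)))).prod 𝓘(ℝ, EuclideanSpace ℝ (Fin (l + 1)))) hypR (y, v) (x.1, ξ)) = 0 :=
    ((congrArg (handleDeriv hkl i y v) e1).trans (congrArg (handleDeriv hkl i y v) hx')).trans h0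
  have h1 : mfderiv ((𝓘(ℝ, EuclideanSpace ℝ (Fin (k + 1)))).prod (𝓡 l)) (𝓡∂ (n + 1)) (handleChart hkl i) (y, v)
      (x.1, ξ) = 0 := hcomp.symm.trans e2
  have h2 : ((x.1, ξ) : EuclideanSpace ℝ (Fin (k + 1)) × EuclideanSpace ℝ (Fin l)) = 0 :=
    injective_mfderiv_handleChart hkl i (q := (y, v)) hy (h1.trans
      (mfderiv ((𝓘(ℝ, EuclideanSpace ℝ (Fin (k + 1)))).prod (𝓡 l)) (𝓡∂ (n + 1)) (handleChart hkl i) (y, v)).map_zero.symm)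
  have hx1 : x.1 = 0 := congrArg Prod.fst h2
  have hξ0 : ξ = 0 := congrArg Prod.snd h2
  refine Prod.ext hx1 ?_
  rw [← hξ, hξ0]
  exact (mfderiv (𝓡 l) 𝓘(ℝ, EuclideanSpace ℝ (Fin (l + 1)))
    (Subtype.val : Metric.sphere (0 : EuclideanSpace ℝ (Fin (l + 1))) 1 → _) v).map_zero

/-! ### The handle cylinder frame -/

variable (h : k + 1 + (l + 1) = n + 1 + 1)

/-- **The handle cylinder frame** at `(y, v)`: `cylR (y, v) h dΨ_{(y,v)}` — tangential parts
`dΨ (eⱼ - ⟪v, (eⱼ)₂⟫ (0, v))`, normal coefficients `⟪v, (eⱼ)₂⟫`.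
[cite: KervaireMilnorAnnals1963, §6 p. 521] -/
def handleCyl (q : EuclideanSpace ℝ (Fin (k + 1)) × Metric.sphere (0 : EuclideanSpace ℝ (Fin (l + 1))) 1) : Fr (n + 1) :=
  cylR (hypR q) h (handleDeriv hkl i q.1 q.2).toLinearMap

/-- Values of the handle cylinder frame. [folklore] -/
theorem handleCyl_apply (q : EuclideanSpace ℝ (Fin (k + 1)) × Metric.sphere (0 : EuclideanSpace ℝ (Fin (l + 1))) 1)
    (j : Fin (n + 1 + 1)) :
    handleCyl hkl i h q j = (handleDeriv hkl i q.1 q.2 (QR (hypR q) (jbasis h j)), bF (hypR q) (jbasis h j)) := rfl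

/-- **The handle cylinder frame is a frame** on the ball (`dΨ` injective on `⟪v, ·₂⟫ = 0`).
[folklore] -/
theorem linearIndependent_handleCyl {q : EuclideanSpace ℝ (Fin (k + 1)) × Metric.sphere (0 : EuclideanSpace ℝ (Fin (l + 1))) 1}
    (hq : ‖q.1‖ < 1) : LinearIndependent ℝ (handleCyl hkl i h q) :=
  linearIndependent_cylR h fun x hx h0 => eq_zero_of_handleDeriv_eq_zero hkl i hq q.2 x hx h0

/-- **The handle cylinder frame is a stable frame field along the handle chart** on the ball:
push-forwards along the handle cone of the continuous fields `q ↦ eⱼ - ⟪v, (eⱼ)₂⟫ (0, v)`.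
[folklore] -/
theorem isFrameFieldAlong_handleCyl :
    IsFrameFieldAlong (𝓡∂ (n + 1)) (handleChart hkl i) (handleCyl hkl i h) {q | ‖q.1‖ < 1} := by
  refine ⟨fun j => ?_, fun j => ?_, fun q hq => linearIndependent_handleCyl hkl i h hq⟩
  · have hhypc : Continuous (hypR (k := k) (l := l)) :=
      continuous_fst.prodMk (continuous_subtype_val.comp continuous_snd)
    have hV : Continuous fun q : EuclideanSpace ℝ (Fin (k + 1)) ×
        Metric.sphere (0 : EuclideanSpace ℝ (Fin (l + 1))) 1 => QR (hypR q) (jbasis h j) := by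
      have : (fun q : EuclideanSpace ℝ (Fin (k + 1)) × Metric.sphere (0 : EuclideanSpace ℝ (Fin (l + 1))) 1 =>
          QR (hypR q) (jbasis h j)) = fun q => ((jbasis h j).1, (jbasis h j).2 -
            ⟪(q.2 : EuclideanSpace ℝ (Fin (l + 1))), (jbasis h j).2⟫ • (q.2 : EuclideanSpace ℝ (Fin (l + 1)))) := by
        funext q; rw [QR_apply]; rfl
      rw [this]
      refine continuous_const.prodMk ?_
      have hu : Continuous fun q : EuclideanSpace ℝ (Fin (k + 1)) ×
          Metric.sphere (0 : EuclideanSpace ℝ (Fin (l + 1))) 1 => (q.2 : EuclideanSpace ℝ (Fin (l + 1))) :=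
        continuous_subtype_val.comp continuous_snd
      have hi : Continuous fun q : EuclideanSpace ℝ (Fin (k + 1)) ×
          Metric.sphere (0 : EuclideanSpace ℝ (Fin (l + 1))) 1 =>
            ⟪(q.2 : EuclideanSpace ℝ (Fin (l + 1))), (jbasis h j).2⟫ := hu.inner continuous_const
      exact continuous_const.sub (hi.smul hu)
    have hsrc := continuousOn_totalSpaceMk_prodSelf (E := EuclideanSpace ℝ (Fin (k + 1)))
      (F := EuclideanSpace ℝ (Fin (l + 1))) (t := {q : EuclideanSpace ℝ (Fin (k + 1)) ×
        Metric.sphere (0 : EuclideanSpace ℝ (Fin (l + 1))) 1 | ‖q.1‖ < 1}) hhypc.continuousOn hV.continuousOn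
    have hO : IsOpen {q : EuclideanSpace ℝ (Fin (k + 1)) × EuclideanSpace ℝ (Fin (l + 1)) |
        ‖q.1‖ < 1 ∧ q.2 ≠ 0} :=
      (isOpen_lt (continuous_norm.comp continuous_fst) continuous_const).inter
        (isOpen_ne.preimage continuous_snd)
    have hpush := ContinuousOn.totalSpaceMk_mfderiv
      (I := (𝓘(ℝ, EuclideanSpace ℝ (Fin (k + 1)))).prod 𝓘(ℝ, EuclideanSpace ℝ (Fin (l + 1))))
      (J := 𝓡∂ (n + 1)) (f := handleCone hkl i) hO
      ((contMDiffOn_handleCone hkl i).of_le (by exact_mod_cast le_top)) hsrc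
      (fun q hq => ⟨hq, ne_zero_of_mem_unit_sphere q.2⟩)
    refine hpush.congr fun q _ => ?_
    rfl
  · have hc : Continuous fun q : EuclideanSpace ℝ (Fin (k + 1)) ×
        Metric.sphere (0 : EuclideanSpace ℝ (Fin (l + 1))) 1 =>
          ⟪(q.2 : EuclideanSpace ℝ (Fin (l + 1))), (jbasis h j).2⟫ :=
      (continuous_subtype_val.comp continuous_snd).inner continuous_const
    exact hc.continuousOn.congr fun q _ => by rw [handleCyl_apply, bF_apply]; rfl

end SphereSurgery

end Literature.Topology.FourManifolds

end
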